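import Mathlib
import Literature.Analysis.FluidPDE.BKMClassVorticityTimeLipschitz
import Literature.Analysis.FluidPDE.VorticityStretching
import Literature.Analysis.FluidPDE.TaoAveragedNondegeneracy
import Literature.Analysis.FluidPDE.HelicityDensityTransport
import Summits.NavierStokesRegularity.NavierStokesRegularity.Theorems.ThreadingFluxHorizonTowerFirstLemmas
import Summits.NavierStokesRegularity.NavierStokesRegularity.Theorems.ThreadingFluxHorizonTowerL2ClosedForm
import HarnessLib

/-!
# Crux `PoloidalLiouville` (stmt-NavierStokesRegularity-1222, W1/W2), crux idea «linear-loop-law» (ns-idea-15 g3,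
# critic V13 PASS-WITH-PRICE): the kernel pieces K-id (`LoopMomentumIdentity`) and K-bridge
# (`FirstOrderLawOfUnthreadedEvolution`) of `Cruxes/PoloidalLiouville/LoopLawSketch.lean`, PROVED (bodies VERBATIM)

Support file (`--supports stmt-NavierStokesRegularity-1222`, helper).  Experiment cell `ns-wall-extremal`, width hand
ns-wall-eng-4 g3.  The sketch's statements have no Theorems-side twin yet, so (as ARM A's `ThreadingFluxHorizonTowerFirstLemmas`
did for the horizon tower) the two theorems below carry the sketch's BODIES VERBATIM, with the sketch-local abbreviations
`loopMomentum v x₀ = fun x => ⟪v x, x − x₀⟫` and `loopBracketAt x₀ f g x = ⟪x − x₀, ∇f x × ∇g x⟫` unfolded.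

* `LoopLaw.loopMomentumIdentity` (K-id, S): for `v ∈ C²` divergence free with `curl v = ∇T × (x − x₀)` off `x₀`
  (`T ∈ C²` off `x₀`), `⟪x − x₀, curl (curl v × v)⟫ = −det(x − x₀, ∇m, ∇T)`, `m = ⟪v, x − x₀⟫` — the order-one threading
  coefficient IS the loop bracket `{m, T}`.
* `LoopLaw.firstOrderLawOfUnthreadedEvolution` (K-bridge, M; DATA LEVEL, non-vacuous): a classical NS solution (`ν = 1`, no force)
  on `[t₀, t₁)`, smooth up to `t₀`, with unthreaded vorticity about `x₀` for `t ∈ (t₀, t₁)`, has a DATUM satisfying the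
  pressure-free order-one condition `⟪x − x₀, curl (ω × u)(t₀)⟫ ≡ 0`.

PROOF of the bridge.  `F(t, x) = ⟪curl u(t) x, x − x₀⟫` vanishes on `(t₀, t₁)`, hence at `t₀` (continuity from the right);
so its one-sided time derivative within `[t₀, t₁)` at `t₀` vanishes; that derivative is `⟪curl ∂ₜ⁺u(t₀) x, x − x₀⟫` (exchange
`∂ₜ curl = curl ∂ₜ` up to the boundary, Literature `IsSmoothSpaceTimeOn.hasDerivWithinAt_curl_slice`); the vorticity equation in
stretching form (Literature `IsClassicalNSSolutionOn.curl_timeDerivWithin_eq`) gives `curl ∂ₜu = Δω − (u·∇)ω + (ω·∇)u =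
Δω − curl(ω × u)` (`curl_cross_apply`, `div u = div ω = 0`); and `⟪x − x₀, Δω⟫ = Δ⟪x − x₀, ω⟫ − 2 div ω = 0` at `t₀`.

HONEST FRAME: kinematics / one-sided calculus for classical solutions; the RUNGS of the card (`PureDegreeShapeRigidity`, …) and
the K-alg lemma are NOT touched; `PoloidalLiouville` (1222), `UnthreadedRigidity` (27585) and NS regularity stay OPEN; W1/W2 movement 0.

## References
* planner ns-idea-15 g3, `Cruxes/PoloidalLiouville/Ideas/linear-loop-law.md`, `…/LoopLawSketch.lean` (K-id, K-bridge).
* A. J. Majda, A. L. Bertozzi, *Vorticity and Incompressible Flow* (CUP 2002), §1.1 (vector identities), §2.1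
  (vorticity equation). [MajdaBertozziCUP2002]
-/

-- the summit and its single problem share the name (D-0017 nested layout)
set_option linter.dupNamespace false

noncomputable section

namespace Summit.NavierStokesRegularity.NavierStokesRegularity.Theorems.PoloidalLiouville.LoopLaw

open Set Function Filter Topology
open scoped Topology RealInnerProductSpace Laplacian ContDiff
open Literature.Analysis.FluidPDE
open Summit.NavierStokesRegularity.NavierStokesRegularity.Theorems.PoloidalLiouville.HorizonTower

/-! ### K-id: the loop-momentum identity -/

/-- **LOOP-MOMENTUM IDENTITY** (K-id of the sketch, body VERBATIM with `loopBracketAt`/`loopMomentum` unfolded): for `v ∈ C²`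
divergence free with `curl v = ∇T × (x − x₀)` off `x₀`, `⟪x − x₀, curl (curl v × v)⟫(x) = −⟪x − x₀, ∇m(x) × ∇T(x)⟫`,
`m = ⟪v, · − x₀⟫`, for every `x ≠ x₀`.  (`curl(ω × v) = −curl(v × ω)`, `⟪y, curl(v × ω)⟫ = ⟪Dv[ω], y⟫ + ⟪v, ω⟫ = ⟪ω, ∇m⟫`,
and `⟪∇T × y, ∇m⟫ = ⟪y, ∇m × ∇T⟫.)  The hypotheses `IsDivFree v` and `ContDiffOn T` are not used. -/
theorem loopMomentumIdentity :
    ∀ (v : E3 → E3) (x₀ : E3) (T : E3 → ℝ), ContDiff ℝ 2 v → VectorCalculus.IsDivFree v →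
    ContDiffOn ℝ 2 T {x₀}ᶜ → (∀ x, x ≠ x₀ → curl v x = cross (gradient T x) (x - x₀)) →
    ∀ x, x ≠ x₀ →
      inner ℝ (x - x₀) (curl (fun z => cross (curl v z) (v z)) x)
        = - inner ℝ (x - x₀) (cross (gradient (fun z => inner ℝ (v z) (z - x₀)) x) (gradient T x)) := by
  intro v x₀ T hv _hdiv _hT hcurl x hx
  have hvd : DifferentiableAt ℝ v x := (hv.differentiable (by norm_num)) x
  have hωd : DifferentiableAt ℝ (curl v) x :=
    ((contDiff_curl (n := 1) (by exact_mod_cast hv)).differentiable (by norm_num)) x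
  -- tangency of `curl v` to the spheres about `x₀` (at `x₀` itself trivially)
  have htan : ∀ z, inner ℝ (curl v z) (z - x₀) = 0 := by
    intro z
    by_cases hz : z = x₀
    · rw [hz, sub_self, inner_zero_right]
    · rw [hcurl z hz, Tao2016.inner_cross_self_right]
  have hdivω : VectorCalculus.divergence (curl v) x = 0 :=
    HelicityDensityTransport.divergence_curl_eq_zero_of_contDiffAt hv.contDiffAt
  -- `curl (ω × v) = −curl (v × ω)`
  have hneg : (fun z => cross (curl v z) (v z)) = fun z => -cross (v z) (curl v z) := by
    funext z
    simp only [cross, ← cross_anticomm (WithLp.ofLp (v z)) (WithLp.ofLp (curl v z)), WithLp.toLp_neg]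
  rw [hneg, curl_neg, inner_neg_right, inner_curl_cross_of_tangent hvd hωd htan hdivω,
    ← inner_gradient_inner_sub v x₀ x hvd (curl v x), hcurl x hx, real_inner_comm,
    ← OrderTwo.inner_cross_cyclic]

/-! ### K-bridge: the first-order law of an unthreaded evolution (one-sided, data level) -/

/-- `Δ ⟪y − x₀, W⟫ = ⟪y − x₀, ΔW⟫ + 2 div W` for a `C²` field `W`. -/
theorem laplacian_inner_sub_const_eq {W : E3 → E3} (hW : ContDiff ℝ 2 W) (x₀ x : E3) :
    (Δ fun y => inner ℝ (y - x₀) (W y)) x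
      = inner ℝ (x - x₀) ((Δ W) x) + 2 * VectorCalculus.divergence W x := by
  set b := stdOrthonormalBasis ℝ E3
  have hid : ContDiff ℝ 2 fun y : E3 => y - x₀ := contDiff_id.sub contDiff_const
  have hΔid : (Δ fun y : E3 => y - x₀) x = 0 := by
    rw [laplacian_eq_sum_fderiv_fderiv b hid x]
    refine Finset.sum_eq_zero fun i _ => ?_
    have : (fun y : E3 => fderiv ℝ (fun y : E3 => y - x₀) y (b i)) = fun _ => b i := by
      funext y
      rw [fderiv_sub_const, fderiv_fun_id]
      rfl
    rw [this, fderiv_fun_const]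
    rfl
  rw [laplacian_inner_eq b hid hW x, hΔid, inner_zero_left, zero_add, divergence_eq_sum_inner_fderiv b]
  congr 2
  refine Finset.sum_congr rfl fun i _ => ?_
  rw [fderiv_sub_const, fderiv_fun_id]
  rfl

/-- **FIRST-ORDER LAW OF AN UNTHREADED EVOLUTION** (K-bridge of the sketch, body VERBATIM; data level, non-vacuous): if a
classical Navier–Stokes solution on `[t₀, t₁)` (smooth up to `t = t₀`, `ν = 1`, no force) has unthreaded vorticity about `x₀`
for `t ∈ (t₀, t₁)`, then its DATUM satisfies the pressure-free order-one condition `⟪x − x₀, curl (ω × u)(t₀)⟫ = 0` for every `x`.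
[cite: MajdaBertozziCUP2002, §1.1 (vector identities), §2.1 (vorticity equation)] -/
theorem firstOrderLawOfUnthreadedEvolution :
    ∀ (u : ℝ → E3 → E3) (p : ℝ → E3 → ℝ) (x₀ : E3) (t₀ t₁ : ℝ), t₀ < t₁ →
    IsClassicalNSSolutionOn (Ico t₀ t₁) 1 0 u p →
    (∀ t ∈ Ioo t₀ t₁, ∀ x : E3, inner ℝ (curl (u t) x) (x - x₀) = 0) →
    ∀ x : E3, inner ℝ (x - x₀) (curl (fun z => cross (curl (u t₀) z) (u t₀ z)) x) = 0 := by
  intro u p x₀ t₀ t₁ ht hsol hF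
  set S : Set ℝ := Ico t₀ t₁ with hSdef
  have hS : UniqueDiffOn ℝ S := uniqueDiffOn_Ico t₀ t₁
  have hcl : S ⊆ closure (interior S) := by
    rw [hSdef, interior_Ico, closure_Ioo ht.ne]
    exact Ico_subset_Icc_self
  have ht₀ : t₀ ∈ S := ⟨le_rfl, ht⟩
  have hu := hsol.smooth_velocity
  -- the one-sided time derivative of `F(·, x)` within `S` at `t₀`, for every `x`
  have hG : ∀ x : E3, HasDerivWithinAt (fun s => inner ℝ (curl (u s) x) (x - x₀))
      (inner ℝ (curl (timeDerivWithin S u t₀) x) (x - x₀)) S t₀ := by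
    intro x
    have h := (hu.hasDerivWithinAt_curl_slice hS hcl ht₀ x).inner (𝕜 := ℝ)
      (hasDerivWithinAt_const t₀ S (x - x₀))
    simpa [inner_zero_right] using h
  -- `F(t₀, x) = 0` by continuity from the right
  have hF₀ : ∀ x : E3, inner ℝ (curl (u t₀) x) (x - x₀) = 0 := by
    intro x
    have hlim : Tendsto (fun s => inner ℝ (curl (u s) x) (x - x₀)) (𝓝[Ioo t₀ t₁] t₀)
        (𝓝 (inner ℝ (curl (u t₀) x) (x - x₀))) :=
      ((hG x).continuousWithinAt.mono Ioo_subset_Ico_self).tendsto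
    have hzero : Tendsto (fun s => inner ℝ (curl (u s) x) (x - x₀)) (𝓝[Ioo t₀ t₁] t₀) (𝓝 0) :=
      tendsto_const_nhds.congr' (eventually_nhdsWithin_of_forall fun s hs => (hF s hs x).symm)
    haveI : (𝓝[Ioo t₀ t₁] t₀).NeBot := by
      rw [nhdsWithin_Ioo_eq_nhdsGT ht]; infer_instance
    exact tendsto_nhds_unique hlim hzero
  have hFS : ∀ x : E3, ∀ s ∈ S, inner ℝ (curl (u s) x) (x - x₀) = 0 := by
    intro x s hs
    rcases eq_or_lt_of_le hs.1 with h | h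
    · rw [← h]; exact hF₀ x
    · exact hF s ⟨h, hs.2⟩ x
  intro x
  -- (i) `⟪curl ∂ₜ⁺u(t₀) x, x − x₀⟫ = 0`
  have hzero' : HasDerivWithinAt (fun s => inner ℝ (curl (u s) x) (x - x₀)) 0 S t₀ :=
    (hasDerivWithinAt_const t₀ S (0 : ℝ)).congr_of_mem (fun s hs => hFS x s hs) ht₀
  have h1 : inner ℝ (curl (timeDerivWithin S u t₀) x) (x - x₀) = 0 :=
    UniqueDiffWithinAt.eq_deriv S (hS t₀ ht₀) (hG x) hzero'
  -- (ii) the vorticity equation within `S` at `t₀`, stretching form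
  have hut : ContDiff ℝ ∞ (u t₀) := hsol.contDiff_velocity ht₀
  have hu2 : ContDiff ℝ 2 (u t₀) := contDiff_infty.1 hut 2
  have hω : ContDiff ℝ 1 (curl (u t₀)) := contDiff_curl (n := 1) (by exact_mod_cast hu2)
  have hω2 : ContDiff ℝ 2 (curl (u t₀)) := contDiff_curl (n := 2) (by exact_mod_cast contDiff_infty.1 hut 3)
  have dud : DifferentiableAt ℝ (u t₀) x := (hut.differentiable (by simp)) x
  have dωd : DifferentiableAt ℝ (curl (u t₀)) x := (hω.differentiable (by norm_num)) x
  have hdivu : VectorCalculus.divergence (u t₀) x = 0 := hsol.divFree t₀ ht₀ x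
  have hdivω : VectorCalculus.divergence (curl (u t₀)) x = 0 :=
    HelicityDensityTransport.divergence_curl_eq_zero_of_contDiffAt hu2.contDiffAt
  have hveq := hsol.curl_timeDerivWithin_eq hS ht₀ x
  simp only [one_smul, Pi.zero_apply, curl_zero, add_zero] at hveq
  -- (iii) `curl (ω × u) = (u·∇)ω − (ω·∇)u`
  have hcross : curl (fun z => cross (curl (u t₀) z) (u t₀ z)) x
      = convect (u t₀) (curl (u t₀)) x - convect (curl (u t₀)) (u t₀) x := by
    rw [curl_cross_apply dωd dud, hdivu, hdivω, zero_smul, zero_smul, sub_zero, add_zero]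
    rfl
  -- (iv) `⟪x − x₀, Δω⟫ = 0` at `t₀`
  have hΔ : inner ℝ (x - x₀) ((Δ (curl (u t₀))) x) = 0 := by
    have hfun : (fun y => inner ℝ (y - x₀) (curl (u t₀) y)) = fun _ => (0 : ℝ) := by
      funext y
      rw [real_inner_comm]
      exact hF₀ y
    have h := laplacian_inner_sub_const_eq hω2 x₀ x
    rw [hfun, laplacian_const_eq_zero, show VectorCalculus.divergence (curl (u t₀)) x = 0 from hdivω,
      mul_zero, add_zero] at h
    exact h.symm
  -- assemble
  have hsplit : curl (fun z => cross (curl (u t₀) z) (u t₀ z)) x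
      = (Δ (curl (u t₀))) x - curl (timeDerivWithin S u t₀) x := by
    rw [hcross, hveq]; abel
  rw [hsplit, inner_sub_right, hΔ, real_inner_comm, h1, sub_zero]

end Summit.NavierStokesRegularity.NavierStokesRegularity.Theorems.PoloidalLiouville.LoopLaw

end
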